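import Literature.AlgebraicGeometry.Motives.CartierDivisorIdealSheaf
import Literature.AlgebraicGeometry.Motives.AbelianVarietyDegree
import Literature.AlgebraicGeometry.Resolution.MarkedIdeals
import Mathlib.AlgebraicGeometry.FunctionField
import HarnessLib

/-!
# The ideal sheaf `𝒪_X(-E) · (z₀, …, zₙ)` of a vector of rational functions

Topic: `Literature/AlgebraicGeometry/Resolution`. Let `X` be an integral scheme and
`z = (z₀, …, zₙ) ∈ K(X)ⁿ⁺¹`, `z ≠ 0`. The `𝒪_X`-submodule `𝔉 = ∑ 𝒪_X z_l ⊆ 𝒦_X` is a fractional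
ideal; it becomes an honest (quasi-coherent) ideal sheaf after multiplication by `𝒪_X(-E)` for any
effective Cartier divisor `E` with `z_l ∈ Γ(X, 𝒪_X(E))` for all `l` ("`div z_l ≥ -E`",
Görtz–Wedhorn I, (11.12.3)), namely `𝒪_X(-E)·𝔉 = ∑_l 𝒪_X(-(E + div z_l))`, the sum of the ideal
sheaves of the effective Cartier divisors `E + div z_l` (`CartierDivisor.IsEffective.idealSheaf`,
`Motives/CartierDivisorIdealSheaf`). This is the twisting device of Liu's proof of Thm. 8.1.24
(*Algebraic Geometry and Arithmetic Curves*, p. 328: "We are going to look for an invertible sheaf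
`𝒩 ⊆ 𝒦_X` such that `𝒩𝓕 ⊆ 𝒪_X` … As `X` is quasi-projective … it admits an ample sheaf `𝓜` …
`𝓜^∨ ↪ 𝒥` … the image `𝓘` is a sheaf of ideals of `𝒪_X`"; Hartshorne II.7.17, proof, Step 4),
with `𝒩 = 𝒪_X(-E)`. Everything here is PROVED:

* `exists_idealSheaf_of_isSection` — for `E ≥ 0` with all `z_l ∈ Γ(X, 𝒪_X(E))` there is a NON-ZERO
  ideal sheaf `I` whose stalk at every `x` is generated by elements `g_l ∈ 𝒪_{X,x}` with rational
  functions `q · z_l`, `q = f_i` the local equation of `E` at `x` (so `I_x = f_i · 𝔉_x`);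
* `exists_isEffective_forall_isSection` — on a quasi-compact `X`, an effective Cartier divisor `H`
  whose complement `X ∖ Supp H` is a (non-empty) AFFINE open clears the poles of every finite
  family of rational functions: some `E = a H + div β + b H ≥ 0` has all `z_l ∈ Γ(X, 𝒪_X(E))`
  (`K(X) = Frac Γ(X ∖ Supp H)` and Görtz–Wedhorn I, Thm. 7.22 (2):
  `CartierDivisor.exists_isSection_pow_mul`);
* `exists_isEffective_forall_isSection_of_hom`, `exists_idealSheaf_of_hom` — hence for `X`
  quasi-compact with an AFFINE morphism `r : X → ℙᵐ_k` (e.g. a closed subscheme of `ℙᵐ_k`), using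
  the hyperplane section `H = div(r^* x_{j₀})` (`GeneratingSections.divisor` of
  `GeneratingSections.ofHom r`, whose complement `r⁻¹ D₊(x_{j₀})` is affine): **every non-zero
  vector of rational functions on a projective variety has a non-zero ideal sheaf
  `I = 𝒪_X(-E)·(z₀, …, zₙ)`**, with the stalk description above.

Also: `isSection_of_smul_le_of_isEffective` (`Γ(𝒪(aD)) ⊆ Γ(𝒪(bD))` for `a ≤ b`, `D ≥ 0`).

## References

* Q. Liu, *Algebraic Geometry and Arithmetic Curves*, OUP 2002, proof of Thm. 8.1.24 (p. 328).
  [Liu2002]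
* R. Hartshorne, *Algebraic Geometry* (1977), II Thm. 7.17 (proof, Step 4) and Example 7.17.3.
  [Hartshorne1977]
* U. Görtz, T. Wedhorn, *Algebraic Geometry I*, 2nd ed. (2020), (11.12.3), Thm. 7.22 (2).
  [GortzWedhorn2020]
-/

noncomputable section

open CategoryTheory AlgebraicGeometry TopologicalSpace
open Literature.AlgebraicGeometry.Motives Literature.AlgebraicGeometry.Motives.RatFn

attribute [local instance] MvPolynomial.gradedAlgebra

namespace Literature.AlgebraicGeometry.Resolution

universe u

variable {X : Scheme.{u}}

/-! ## Two small lemmas -/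

/-- Stalks commute with suprema of ideal sheaves (a copy of `stalkIdeal_iSup` of
`MarkedIdealsHomogenized.lean`, kept private to keep the imports light). [folklore] -/
private theorem stalkIdeal_iSup' {ι : Type*} (I : ι → X.IdealSheafData) (x : X) :
    stalkIdeal (⨆ i, I i) x = ⨆ i, stalkIdeal (I i) x := by
  obtain ⟨U, hU, hxU, -⟩ :=
    exists_isAffineOpen_mem_and_subset (X := X) (x := x) (U := ⊤) (Opens.mem_top x)
  rw [stalkIdeal_eq_map_germ _ ⟨U, hU⟩ hxU, Scheme.IdealSheafData.ideal_iSup, iSup_apply,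
    Ideal.map_iSup]
  simp only [stalkIdeal_eq_map_germ _ ⟨U, hU⟩ hxU]

/-- The stalks of the zero ideal sheaf vanish. [folklore] -/
private theorem stalkIdeal_bot' (x : X) : stalkIdeal (⊥ : X.IdealSheafData) x = ⊥ := by
  obtain ⟨U, hU, hxU, -⟩ :=
    exists_isAffineOpen_mem_and_subset (X := X) (x := x) (U := ⊤) (Opens.mem_top x)
  rw [stalkIdeal_eq_map_germ _ ⟨U, hU⟩ hxU, Scheme.IdealSheafData.ideal_bot, Pi.bot_apply,
    Ideal.map_bot]

variable [IsIntegral X]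

/-- **`Γ(X, 𝒪_X(aD)) ⊆ Γ(X, 𝒪_X(bD))` for `a ≤ b` and `D ≥ 0`** (multiplication by the canonical
section `s_D^{b-a}`, Görtz–Wedhorn I, (11.12)). [folklore] -/
theorem isSection_of_smul_le_of_isEffective
    {D : CartierDivisor X} (hD : D.IsEffective) {a b : ℕ} (hab : a ≤ b) {s : X.functionField}
    (hs : (a • D).IsSection s) : (b • D).IsSection s := by
  intro i x hi
  obtain ⟨c, rfl⟩ := Nat.exists_eq_add_of_le hab
  rw [CartierDivisor.smul_f, pow_add, mul_comm (D.f i ^ a), mul_assoc]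
  exact ((hD i x hi).pow c).mul (hs i x hi)

/-! ## The ideal sheaf `∑_l 𝒪_X(-(E + div z_l))` and its stalks -/

/-- **The ideal sheaf `𝒪_X(-E)·(z₀, …, zₙ)`.** For a Cartier divisor `E` on the integral scheme `X`
and rational functions `z₀, …, zₙ`, not all zero, with `z_l ∈ Γ(X, 𝒪_X(E))` for all `l` (i.e.
`E + div z_l ≥ 0`, Görtz–Wedhorn I, (11.12.3); `E ≥ 0` in the application), the ideal sheaf
`I = ∑_{z_l ≠ 0} 𝒪_X(-(E + div z_l))` is non-zero, and at every point `x` (in a chart `U_i ∋ x` of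
`E`, local equation `f_i`) its stalk is `I_x = (g₀, …, gₙ)` with `g_l ∈ 𝒪_{X,x}` the element with
rational function `f_i z_l`: `I_x = f_i · ∑_l 𝒪_{X,x} z_l` inside `K(X)` (Liu 2002, proof of
Thm. 8.1.24: `𝒩𝓕 = 𝓘` with `𝒩` invertible). [cite: Liu2002, Thm. 8.1.24 (proof, p. 328)] -/
theorem exists_idealSheaf_of_isSection (E : CartierDivisor X) {n : ℕ}
    (z : Fin (n + 1) → X.functionField) (hz : ∀ l, E.IsSection (z l)) (hz0 : z ≠ 0) :
    ∃ I : X.IdealSheafData, I ≠ ⊥ ∧ ∀ x : X, ∃ q : X.functionField, q ≠ 0 ∧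
      ∃ g : Fin (n + 1) → X.presheaf.stalk x, (∀ l, toFunctionField x (g l) = q * z l) ∧
        stalkIdeal I x = Ideal.span (Set.range g) := by
  classical
  -- the effective divisors `E + div z_l`
  have hDl : ∀ l (hl : z l ≠ 0), (E + CartierDivisor.principal (z l) hl).IsEffective :=
    fun l hl => (CartierDivisor.isEffective_add_principal_iff hl).mpr (hz l)
  let Il : Fin (n + 1) → X.IdealSheafData := fun l =>
    if hl : z l = 0 then ⊥ else (hDl l hl).idealSheaf
  have hIl_ne : ∀ l, (hl : z l ≠ 0) → Il l = (hDl l hl).idealSheaf := fun l hl => dif_neg hl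
  have hIl_eq : ∀ l, z l = 0 → Il l = ⊥ := fun l hl => dif_pos hl
  refine ⟨⨆ l, Il l, ?_, ?_⟩
  · -- `I ≠ 0`: it contains `𝒪_X(-(E + div z_{l₀}))` for some `z_{l₀} ≠ 0`
    obtain ⟨l₀, hl₀⟩ := Function.ne_iff.mp hz0
    intro hbot
    have hle : Il l₀ ≤ ⨆ l, Il l := le_iSup Il l₀
    rw [hbot, le_bot_iff, hIl_ne l₀ hl₀] at hle
    obtain ⟨i, hi⟩ := E.covers (genericPoint X)
    obtain ⟨W, hxW, hWi, -, t, ht⟩ := (hDl l₀ hl₀).exists_affine_secFn_eq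
      (i := (i, PUnit.unit)) (y := genericPoint X) ⟨hi, trivial⟩ (O := ⊤) trivial
    have hIW : (hDl l₀ hl₀).idealSheaf.ideal W = Ideal.span {t} := by
      rw [CartierDivisor.IsEffective.ideal_idealSheaf, CartierDivisor.sectionIdeal_eq_span hxW hWi ht]
    rw [hle, Scheme.IdealSheafData.ideal_bot, Pi.bot_apply] at hIW
    have ht0 : t ≠ 0 := by
      intro h0
      apply (E + CartierDivisor.principal (z l₀) hl₀).f_ne_zero (i, PUnit.unit)
      rw [← ht, h0, secFn_zero]
    apply ht0
    have htm : t ∈ (⊥ : Ideal Γ(X, W)) := by rw [hIW]; exact Ideal.mem_span_singleton_self t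
    simpa using htm
  · intro x
    obtain ⟨i, hi⟩ := E.covers x
    refine ⟨E.f i, E.f_ne_zero i, ?_⟩
    -- a generator of each stalk `𝒪_X(-(E + div z_l))_x`, with rational function `f_i z_l`
    have hgen : ∀ l, ∃ g : X.presheaf.stalk x, toFunctionField x g = E.f i * z l ∧
        stalkIdeal (Il l) x = Ideal.span {g} := by
      intro l
      by_cases hl : z l = 0
      · refine ⟨0, by rw [map_zero, hl, mul_zero], ?_⟩
        rw [hIl_eq l hl, stalkIdeal_bot', Ideal.span_singleton_eq_bot.mpr rfl]
      · obtain ⟨W, hxW, hWi, -, t, ht⟩ := (hDl l hl).exists_affine_secFn_eq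
          (i := (i, PUnit.unit)) (y := x) ⟨hi, trivial⟩ (O := ⊤) trivial
        refine ⟨X.presheaf.germ W x hxW t, ?_, ?_⟩
        · rw [toFunctionField_germ_eq_secFn hxW hxW, ht]
          rfl
        · rw [hIl_ne l hl, stalkIdeal_eq_map_germ _ W hxW, CartierDivisor.IsEffective.ideal_idealSheaf,
            CartierDivisor.sectionIdeal_eq_span hxW hWi ht, Ideal.map_span, Set.image_singleton]
    choose g hg₁ hg₂ using hgen
    refine ⟨g, hg₁, ?_⟩
    rw [stalkIdeal_iSup', ← Set.iUnion_singleton_eq_range, Ideal.span_iUnion]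
    exact iSup_congr hg₂

/-! ## Clearing poles with a divisor whose complement is affine -/

/-- **An effective Cartier divisor with affine complement clears the poles of finitely many
rational functions.** On a quasi-compact integral scheme `X`, let `H ≥ 0` be a Cartier divisor
whose open complement `X ∖ Supp H` (the non-vanishing locus of its canonical section `1`) is a
non-empty affine open `V`. Then for every finite family `z` of rational functions there is an
effective Cartier divisor `E` with `z_l ∈ Γ(X, 𝒪_X(E))` for all `l`: write `z_l = α_l / β` with
`α_l, β ∈ Γ(V, 𝒪_X)` (`K(X) = Frac Γ(V, 𝒪_X)`), extend `α_l`, `β` to sections of `𝒪_X(aH)`,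
`𝒪_X(bH)` (Görtz–Wedhorn I, Thm. 7.22 (2), `CartierDivisor.exists_isSection_pow_mul`) and take
`E = (bH + div β) + aH`. [cite: GortzWedhorn2020, Thm. 7.22 (2) (p. 230)] -/
theorem exists_isEffective_forall_isSection [CompactSpace X] (H : CartierDivisor X)
    (hH : H.IsEffective) (V : X.Opens) (hV : IsAffineOpen V) (hVne : (V : Set X).Nonempty)
    (hHV : H.nonvanishing 1 = (V : Set X)) {ι : Type*} [Finite ι] (z : ι → X.functionField) :
    ∃ E : CartierDivisor X, E.IsEffective ∧ ∀ l, E.IsSection (z l) := by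
  classical
  haveI : Nonempty V := hVne.to_subtype
  haveI := functionField_isFractionRing_of_isAffineOpen X V hV
  have hη : genericPoint X ∈ V := by
    obtain ⟨x, hx⟩ := hVne
    exact genericPoint_mem_of_mem hx
  -- common denominator: `b • z_l = a_l`
  obtain ⟨⟨b, hb⟩, hbz⟩ :=
    IsLocalization.exist_integer_multiples_of_finite (nonZeroDivisors Γ(X, V)) z
  choose a ha using fun l => hbz l
  -- the rational functions of `a_l`, `b`
  have halg : ∀ s : Γ(X, V), algebraMap Γ(X, V) X.functionField s = ofSection hη s := fun s => rfl
  have hb0 : ofSection hη b ≠ 0 := by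
    rw [← halg]
    exact IsFractionRing.to_map_ne_zero_of_mem_nonZeroDivisors hb
  have hza : ∀ l, z l = (ofSection hη b)⁻¹ * ofSection hη (a l) := by
    intro l
    have e : ofSection hη (a l) = ofSection hη b * z l := by
      rw [← halg, ← halg, ha l, Algebra.smul_def]
    rw [e, ← mul_assoc, inv_mul_cancel₀ hb0, one_mul]
  -- sections over `V` extend to sections of `𝒪_X(N H)`
  have h1 : ((1 : ℕ) • H).IsSection 1 := by
    rw [H.one_smul]
    exact hH.isSection_one
  have hnv : ((1 : ℕ) • H).nonvanishing 1 = (V : Set X) := by rw [H.one_smul, hHV]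
  have hreg : ∀ s : Γ(X, V), ∃ N : ℕ, (N • H).IsSection (ofSection hη s) := by
    intro s
    obtain ⟨N, hN⟩ := H.exists_isSection_pow_mul h1 (β := ofSection hη s) (fun x hx => by
      rw [hnv] at hx
      exact isRegularAt_ofSection hx s)
    refine ⟨N, ?_⟩
    simpa only [one_mul, one_pow] using hN
  choose N hN using hreg
  -- `E = (N_b H + div β) + N_a H`
  haveI : Fintype ι := Fintype.ofFinite ι
  let Na : ℕ := Finset.univ.sup fun l => N (a l)
  have hNa : ∀ l, N (a l) ≤ Na := fun l => Finset.le_sup (f := fun l => N (a l)) (Finset.mem_univ l)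
  let D₁ : CartierDivisor X := N b • H + CartierDivisor.principal (ofSection hη b) hb0
  have hD₁ : D₁.IsEffective := (CartierDivisor.isEffective_add_principal_iff hb0).mpr (hN b)
  have hD₁inv : D₁.IsSection (ofSection hη b)⁻¹ := by
    rintro ⟨i, u⟩ x ⟨hi, -⟩
    change IsRegularAt x ((N b • H).f i * ofSection hη b * (ofSection hη b)⁻¹)
    rw [mul_assoc, mul_inv_cancel₀ hb0, mul_one, CartierDivisor.smul_f]
    exact (hH i x hi).pow _
  refine ⟨D₁ + Na • H, hD₁.add (hH.smul Na), fun l => ?_⟩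
  rw [hza l]
  exact CartierDivisor.isSection_add_mul hD₁inv (isSection_of_smul_le_of_isEffective hH (hNa l) (hN (a l)))

/-- **On a projective variety every finite family of rational functions has a common pole-clearing
effective Cartier divisor.** For `X` integral and quasi-compact with an AFFINE morphism
`r : X → ℙᵐ_k` (e.g. a closed immersion), the hyperplane section `H = div(r^* x_{j₀})`
(`GeneratingSections.divisor`) is effective with affine complement `r⁻¹ D₊(x_{j₀})`, so
`exists_isEffective_forall_isSection` applies. (Liu 2002, proof of Thm. 8.1.24: "As `X` is
quasi-projective over an affine scheme, it admits an ample sheaf `𝓜` … `𝓜^∨ ↪ 𝒥`".)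
[cite: Liu2002, Thm. 8.1.24 (proof, p. 328)] -/
theorem exists_isEffective_forall_isSection_of_hom [CompactSpace X] {m : ℕ} {k : Type u}
    [CommRing k] (r : X ⟶ Proj (Segre.grading (Fin (m + 1)) k)) [IsAffineHom r]
    {ι : Type*} [Finite ι] (z : ι → X.functionField) :
    ∃ E : CartierDivisor X, E.IsEffective ∧ ∀ l, E.IsSection (z l) := by
  let G := GeneratingSections.ofHom r
  obtain ⟨j₀, hj₀⟩ := G.exists_mem_U (genericPoint X)
  let H := G.divisor j₀ hj₀
  have hH : H.IsEffective := fun i x hi => G.isRegularAt_ratioFn j₀ hi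
  have hHV : H.nonvanishing 1 = (G.U j₀ : Set X) := by
    have h := G.nonvanishing_divisor_ratioFn j₀ hj₀ j₀
    rwa [G.ratioFn_self] at h
  exact exists_isEffective_forall_isSection H hH (G.U j₀)
    (GeneratingSections.isAffineOpen_ofHom_U r j₀) ⟨_, hj₀⟩ hHV z

/-- **The ideal sheaf of a rational map from a projective variety** (the twist `𝓘 = 𝒩𝓕` of Liu's
proof of Thm. 8.1.24, Hartshorne II.7.17 Step 4 / Example 7.17.3): for `X` integral and
quasi-compact with an affine morphism to some `ℙᵐ_k` and `z ∈ K(X)ⁿ⁺¹ ∖ 0`, there is a non-zero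
ideal sheaf `I` on `X` such that for every `x ∈ X` there are `q ∈ K(X)^×` and generators
`g₀, …, gₙ` of the stalk `I_x` whose rational functions are `q z₀, …, q zₙ`
(`I_x = q · ∑ 𝒪_{X,x} z_l`). [cite: Liu2002, Thm. 8.1.24 (proof, p. 328)] -/
theorem exists_idealSheaf_of_hom [CompactSpace X] {m : ℕ} {k : Type u} [CommRing k]
    (r : X ⟶ Proj (Segre.grading (Fin (m + 1)) k)) [IsAffineHom r] {n : ℕ}
    (z : Fin (n + 1) → X.functionField) (hz0 : z ≠ 0) :
    ∃ I : X.IdealSheafData, I ≠ ⊥ ∧ ∀ x : X, ∃ q : X.functionField, q ≠ 0 ∧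
      ∃ g : Fin (n + 1) → X.presheaf.stalk x, (∀ l, toFunctionField x (g l) = q * z l) ∧
        stalkIdeal I x = Ideal.span (Set.range g) := by
  obtain ⟨E, -, hEz⟩ := exists_isEffective_forall_isSection_of_hom r z
  exact exists_idealSheaf_of_isSection E z hEz hz0

end Literature.AlgebraicGeometry.Resolution

end
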